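import Summits.QuantumFields.BalabanUV.T4Continuum.Spine.NE9.TowerCarriers
import Literature.MathematicalPhysics.QuantumFieldTheory.Balaban1983to89.T4CouplingAnalyticity

/-!
# T⁴ programme, spine estimate NE9 (node U3, history side) — THE TOWER OF CARRIERS OVER A GENERAL COUPLING BOX, AND THE ANALYTIC
# BRANCH ALONG THE TOWER IN NODE U2's NATIVE t-CURRENCY: GIVEN tower-NE5, coordinatewise holomorphy of every scale-`m` term in EVERY young
# coupling on RELATIVE discs (the [H-dil] shape `T4CouplingAnalyticity.CouplingAnalyticRel`) with a level-uniform bound closes node U3 → U6 —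
# with NO step-transfer ∕ renewal analysis, NO memory-rate gap, NO vertex weight, NO `FadingMemory`, NO clause N2
# (census item C29 of cell `pub-balaban-gaps`, seat ne9, gen 5)

Cell `pub-balaban-gaps` (YM blitz G2, seat ne9, unit `pub-balaban-gaps-ne9-g5`; record `run/shared/lean/pub/pub-balaban-gaps/ne/NE9.md` §5 row
C29).  Summits-side bookkeeping; by-name inputs: gen 3's `MemoryFromRate.{bracket_le_of_bounded, bracket_le_of_growing, summable_delta_of_bounded,
firstMoment_profiles}` (the abstract tower END, GENERIC in the window), gen 4's `TowerCarriers.{TowerData, prepend, extendTower, extendModuli,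
extendTower_rate, extendTower_moduli, extendModuli_bound, TowerNE5, TowerNE9}`, the NE9 owner lineage's (`b2b-balaban-t4-ne9-p1`, GEN 3–4)
`T4CouplingAnalyticity.{BoxWindow, CouplingAnalyticRel, ne9T_of_couplingAnalyticRel, window_eq_boxWindow}`, and pv16's `T4CouplingMatching.disc`
(node U2's t-discrepancy).  Two PARAMETRIC PROPOSITIONS are defined (`TowerNE5On`, `TowerNE9On` — gen 4's `TowerNE5`∕`TowerNE9` with the
g-window `T4OutputRate.Window γ = BoxWindow ]0, γ]` replaced by an arbitrary coordinate box `BoxWindow I`; at `I = ]0, γ]` they ARE gen 4's,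
`towerNE5On_Ioc_iff`∕`towerNE9On_Ioc_iff`); nothing is asserted.

WHY.  Gen 3–4 (C24–C28) showed: GIVEN tower-NE5 (`T4OutputRate.NE5` at every pair of consecutive run lengths), node U3 → U6 consumes from the
E-side only a quantitative modulus of continuity of the scale-`m` term in its YOUNG couplings — BOUNDED moduli suffice against any discrepancy
profile of finite first moment (`MemoryFromRate.bracket_le_of_bounded`), no decay, no contraction clause.  That was typed on the g-WINDOW
`Window γ` with discrepancies `|g_i − g'_i|`.  The NE9 owner lineage had earlier located (T4CouplingAnalyticity (L5), GAPS G-ne9p1-6∕-8) that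
what print's analytic branch ([Balaban1987RG1] p. 263 *"(or analytic)"*, p. 266 *"the functions E^{(j)}, β_j are analytic functions of the
effective coupling constants"*) can support is holomorphy on RELATIVE coupling discs (`CouplingAnalyticRel`: radius `c·|s|` about `s`; in
`t = 1∕g²` a dilation disc), which by Cauchy gives NE9 in the t-CURRENCY over the t-box `[t₀, ∞[` with BOUNDED, NON-FADING moduli
`4M∕(c·t₀)` (`ne9T_of_couplingAnalyticRel`) — and NOT the g-form on `Window γ` (vertex no-go `exists_couplingAnalyticRel_not_ne9Window`,
wall W5); to reach node U2∕U3 from it, `T4CurrencyMatching` (GEN 4) needed geometric moduli from the dilation STEP ((AN-OLD) + (CONTR)) and a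
MEMORY-RATE GAP `μ < ρ`.  THIS FILE puts the two together: `MemoryFromRate` is generic in the window, node U2's NATIVE output IS the
t-discrepancy (`T4CouplingMatching.disc gA gB i = |1∕(gA i)² − 1∕(gB (i+1))²|`, weight 1 — `abs_invSq_sub_eq_disc`), so on the t-box:
  tower-NE5 + [`CouplingAnalyticRel` in EVERY young coupling at EVERY level, ONE bound `M`] + [`disc ≤ d`, `Σ (i+1)·d_i < ∞`] ⇒ node U3's bracket
  majorant `e^{−κd(X)}·[2C₅θ^{m∕2}∕(1−θ) + (4M∕(c t₀))·Σ_{i∈[m∕2,m)} d_i]` ⇒ node U6's `Summable (T4CauchySum.delta E₀ ρ inj)`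
(`summable_delta_of_analyticBranch`).  NOTHING of the step-transfer route is used: no `StepLipschitz`∕`StepTransfer`, no renewal, no (AN-OLD),
no (CONTR), no memory-rate gap, no vertex weight (W5), no `FadingMemory`, no clause N2.  What the E-side then owes node U3 → U6, GIVEN tower-NE5,
is ONE statement of printed TYPE: the decay bound (1.18) for each scale-`m` term as a holomorphic function of EACH young coupling separately on a
relative complex disc (the others real in the box) — the analytic-branch inductive hypothesis of [I] p. 266 read with a domain (H∃: print names
no domain and no bound; the owner lineage's (L5) reads the last coupling as a dilation parameter of (2.10) p. 267; for an OLDER coupling the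
located structure (L1)∕(L4) routes it through the old terms, which the printed step uses through absolute values only, (2.15) p. 15 of [II]) —
for Bałaban's `E^{(j)}` still the one-step object W1 instantiated (0∕1), so the classification of row NE9 is UNCHANGED in kind; the E-side
OBLIGATION LIST of node U3 → U6 is now the shortest typed: {tower-NE5 (row NE5), relative-disc coupling holomorphy with the (1.18) bound}.

WHAT IS TYPED AND PROVED (0 sorry):
* §0 box windows are shift-, mix-, prepend- and ageing-closed (`shift_mem_boxWindow`, `mix_mem_boxWindow`, `prepend_mem_boxWindow`,
  `age_mem_boxWindow`).
* §1 `TowerNE5On T E I κ θ C₅` ∕ `TowerNE9On T E I κ Λ` [parametric propositions] and `towerNE5On_Ioc_iff` ∕ `towerNE9On_Ioc_iff` (at `I = ]0,γ]`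
  they are gen 4's `TowerNE5` ∕ `TowerNE9` — `Iff` by `window_eq_boxWindow`, definitional).
* §2 the junction over the box, gen 4's §3 verbatim with `Window γ ↦ BoxWindow I`: `rate_of_towerNE5On`, `section_towerOn`,
  `bracket_le_of_towerOn_bounded`, `bracket_le_of_towerOn_growing`, and the bounded END-to-END `summable_delta_of_towerOn_bounded` (tower-NE5 +
  tower-NE9 with BOUNDED moduli + ANY profile of finite first moment ⇒ domination of every bracket by a cutoff-free injection + `Summable delta`;
  gen 4 typed the END-to-END only in the growing∕geometric regime).
* §3 THE ANALYTIC BRANCH: `towerNE9On_of_couplingAnalyticRel` (prefix dependence + `CouplingAnalyticRel [t₀,∞[ (E k) κ M c` at every level ⇒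
  `TowerNE9On T E [t₀,∞[ κ (4M∕(c t₀))` — `ne9T_of_couplingAnalyticRel` BY NAME), `bracket_le_of_analyticBranch`, **`summable_delta_of_analyticBranch`**.
* §4 DICTIONARY to node U2: `abs_invSq_sub_eq_disc` (the t-discrepancy of the paired histories IS pv16's `disc`, by `rfl`), `invSq_mem_boxWindow`
  (g-window histories have t-histories in the t-box `[γ⁻², ∞[`), and the two profiles of the cell (`summable_delta_of_analyticBranch_geometric`:
  record `C·θ′^i`; `summable_delta_of_analyticBranch_sqrt`: (E33g)'s K-uniform `L·ρ^⌊√i⌋`, NO β-side fading) via `firstMoment_profiles` BY NAME.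

HONEST FRAMING: bookkeeping for rung (B)+1 on ONE FIXED finite four-torus; real∕complex analysis on hypothesis SHAPES; tower-NE5 is the cell's
estimate NE5 (NOT PRINTED, NOT PROVED) assumed for every consecutive pair of run lengths; `CouplingAnalyticRel` for Bałaban's terms is NOT PRINTED
(H∃ reading of [I] p. 266) and NOT PROVED; NE9 NOT PRINTED ∕ NOT PROVED; spine PROVED 0∕9 unchanged; instance 0∕1; nothing of Bałaban's asserted;
NOT UV stability, NOT the continuum limit, NOT infinite volume, NOT a mass gap, NOT Clay.  HONEST DEPENDENCY: continuum YM on T⁴ ⇐ BetaPertH ∧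
nine spine estimates (0∕9 proved); BetaPertH ⇐ (D1) ∧ (D4) ∧ CAP+tail.

References (TYPES only): [Balaban1987RG1] = T. Bałaban, Commun. Math. Phys. **109** (1987) 249–301, Thm 1 p. 259, (1.18) p. 263, p. 266, (2.10)
p. 267; [Balaban1988RG2Cluster] = T. Bałaban, Commun. Math. Phys. **116** (1988) 1–22, (1.34) p. 9, (2.15) p. 15.
-/

namespace Summit.QuantumFields.BalabanUV.T4Continuum.NE9.TowerCarriersBox

open scoped BigOperators
open Finset
open Literature.MathematicalPhysics.QuantumFieldTheory.Balaban1983to89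
open Literature.MathematicalPhysics.QuantumFieldTheory.Balaban1983to89.T4OutputRate
open Literature.MathematicalPhysics.QuantumFieldTheory.Balaban1983to89.T4CouplingAnalyticity
  (BoxWindow CouplingAnalyticRel ne9T_of_couplingAnalyticRel window_eq_boxWindow)
open T4CauchySum (delta)
open Summit.QuantumFields.BalabanUV.T4Continuum.NE9.MemoryFromRate
open Summit.QuantumFields.BalabanUV.T4Continuum.NE9.TowerCarriers

/-! ## §0 Box windows are shift-, mix-, prepend- and ageing-closed -/

/-- A box is closed under dropping the oldest coupling. [folklore] -/
theorem shift_mem_boxWindow {I : Set ℝ} {g : ℕ → ℝ} (hg : g ∈ BoxWindow I) : (fun i => g (i + 1)) ∈ BoxWindow I :=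
  fun i => hg (i + 1)

/-- A box is closed under ageing by `k` scales. [folklore] -/
theorem age_mem_boxWindow {I : Set ℝ} {g : ℕ → ℝ} (hg : g ∈ BoxWindow I) (k : ℕ) : (fun i => g (i + k)) ∈ BoxWindow I :=
  fun i => hg (i + k)

/-- A box is closed under hybrids (old block of one history, young block of another). [folklore] -/
theorem mix_mem_boxWindow {I : Set ℝ} {g g' : ℕ → ℝ} (hg : g ∈ BoxWindow I) (hg' : g' ∈ BoxWindow I) (a : ℕ) :
    (fun i => if i < a then g' i else g i) ∈ BoxWindow I := by
  intro i
  by_cases h : i < a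
  · simp only [h, if_true]; exact hg' i
  · simp only [h, if_false]; exact hg i

/-- A box is closed under prepending an admissible unpaired coupling. [folklore] -/
theorem prepend_mem_boxWindow {I : Set ℝ} {b : ℝ} (hb : b ∈ I) {g : ℕ → ℝ} (hg : g ∈ BoxWindow I) :
    prepend b g ∈ BoxWindow I := by
  intro i
  cases i with
  | zero => exact hb
  | succ i => exact hg i

/-! ## §1 Tower-NE5 ∕ tower-NE9 over a general coupling box -/

/-- **TOWER-NE5 OVER THE BOX `BoxWindow I`**: for every run length `k` and every admissible unpaired bare coupling `b ∈ I` of run `k + 1`,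
`T4OutputRate.NE5` on the level-`k` pair carriers for run `k`'s functional and run `k + 1`'s with `b` prepended, window `BoxWindow I` — gen 4's
`TowerNE5` with the g-window `]0, γ]` replaced by an arbitrary coordinate set `I` (t-currency: `I = [t₀, ∞[`; log-currency: `I = exp⁻¹ …`).
NOT PRINTED (cell estimate NE5; print: [Balaban1987RG1] Thm 1 p. 259 uniformity in the lattice spacing only).  A parametric definition of a
proposition, consumed only as a hypothesis — nothing asserted. [folklore] -/
def TowerNE5On (T : TowerData) (E : ℕ → (ℕ → ℝ) → T.B → T.Dom → ℝ) (I : Set ℝ) (κ θ C₅ : ℝ) : Prop :=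
  ∀ k : ℕ, ∀ b ∈ I, NE5 (C := T.level k) (E k) (fun g U X => E (k + 1) (prepend b g) U X) (BoxWindow I) κ θ C₅

/-- **TOWER-NE9 OVER THE BOX `BoxWindow I`**: `T4OutputRate.NE9` on the level-`k` carriers for run `k`'s functional, every `k`, window
`BoxWindow I`, one scale-covariant moduli family `Λ` (the Lipschitz half in the currency of `I`; no `FadingMemory`).  NOT PRINTED (cell estimate
NE9; print: [Balaban1987RG1] p. 263 C^∞ ∕ analytic in the last coupling, p. 298 dependence on the preceding ones).  A parametric definition of
a proposition, consumed only as a hypothesis — nothing asserted. [folklore] -/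
def TowerNE9On (T : TowerData) (E : ℕ → (ℕ → ℝ) → T.B → T.Dom → ℝ) (I : Set ℝ) (κ : ℝ) (Λ : ℕ → ℕ → ℝ) : Prop :=
  ∀ k : ℕ, NE9 (C := T.level k) (E k) (BoxWindow I) κ Λ

variable (T : TowerData) {E : ℕ → (ℕ → ℝ) → T.B → T.Dom → ℝ}

/-- At `I = ]0, γ]` the box tower-NE5 IS gen 4's `TowerNE5` (`Window γ = BoxWindow ]0, γ]` definitionally). [folklore] -/
theorem towerNE5On_Ioc_iff {γ κ θ C₅ : ℝ} : TowerNE5On T E (Set.Ioc 0 γ) κ θ C₅ ↔ TowerNE5 T E γ κ θ C₅ := by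
  unfold TowerNE5On TowerNE5
  rw [window_eq_boxWindow]
  exact ⟨fun h k b hb0 hbγ => h k b ⟨hb0, hbγ⟩, fun h k b hb => h k b hb.1 hb.2⟩

/-- At `I = ]0, γ]` the box tower-NE9 IS gen 4's `TowerNE9`. [folklore] -/
theorem towerNE9On_Ioc_iff {γ κ : ℝ} {Λ : ℕ → ℕ → ℝ} : TowerNE9On T E (Set.Ioc 0 γ) κ Λ ↔ TowerNE9 T E γ κ Λ := by
  unfold TowerNE9On TowerNE9
  rw [window_eq_boxWindow]

/-! ## §2 The junction over the box: tower-NE5∕NE9 ⇒ the abstract tower ⇒ node U3's bracket and node U6 -/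

variable {I : Set ℝ}

/-- ONE LEVEL: tower-NE5 at run `k` with `b = g 0` is the abstract tower rate between runs `k + 1` and `k`, rate `θ^{k − r X}`. [folklore] -/
theorem rate_of_towerNE5On {κ θ C₅ : ℝ} (h5 : TowerNE5On T E I κ θ C₅) (k : ℕ) {g : ℕ → ℝ} (hg : g ∈ BoxWindow I)
    (U : T.B) (X : T.Dom) :
    |E (k + 1) g U X - E k (fun i => g (i + 1)) (T.tr k U) X| ≤ C₅ * θ ^ (k - T.r X) * Real.exp (-(κ * T.d X)) := by
  have h : |E k (fun i => g (i + 1)) (T.tr k U) X - E (k + 1) (prepend (g 0) fun i => g (i + 1)) U X| ≤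
      C₅ * θ ^ (k - T.r X) * Real.exp (-(κ * T.d X)) :=
    h5 k (g 0) (hg 0) _ (shift_mem_boxWindow hg) U X
  rw [prepend_head_tail] at h
  rwa [abs_sub_comm]

/-- **THE SECTION OF THE TOWER AT `(k, U, X)` OVER THE BOX** (`r X ≤ k`): the sequence `m ↦ e^{κd(X)}·E (r X + m) g (descend k U (r X + m)) X`,
extended above `m₀ = k − r X` (gen 4's `extendTower`), satisfies `MemoryFromRate`'s GLOBAL hypotheses on the window `BoxWindow I` — tower rate
`C₅θ^m` (from `TowerNE5On`), moduli (from `TowerNE9On`) under the same age profile `G` — and its level-`m₀` term is `e^{κd(X)}·E k g U X`.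
Gen 4's `section_tower` with `Window γ ↦ BoxWindow I`, verbatim. [folklore] -/
theorem section_towerOn {κ θ C₅ : ℝ} {Λ : ℕ → ℕ → ℝ} {G : ℕ → ℝ} (hC : 0 ≤ C₅) (hθ : 0 ≤ θ)
    (h5 : TowerNE5On T E I κ θ C₅) (h9 : TowerNE9On T E I κ Λ)
    (hG : ∀ a, 0 ≤ G a) (hΛ : ∀ m j, j < m → 0 ≤ Λ m j ∧ Λ m j ≤ G (m - j))
    (k : ℕ) (U : T.B) (X : T.Dom) (hX : T.r X ≤ k) :
    ∃ (F : ℕ → (ℕ → ℝ) → ℝ) (Λ' : ℕ → ℕ → ℝ),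
      (∀ g, F (k - T.r X) g = Real.exp (κ * T.d X) * E k g U X) ∧
      (∀ m, ∀ g ∈ BoxWindow I, |F (m + 1) g - F m (fun i => g (i + 1))| ≤ C₅ * θ ^ m) ∧
      (∀ m, ∀ g ∈ BoxWindow I, ∀ g' ∈ BoxWindow I, |F m g - F m g'| ≤ ∑ i ∈ range m, Λ' m i * |g i - g' i|) ∧
      (∀ m j, j < m → 0 ≤ Λ' m j ∧ Λ' m j ≤ G (m - j)) := by
  set m₀ := k - T.r X with hm₀
  set F₀ : ℕ → (ℕ → ℝ) → ℝ :=
    fun m g => Real.exp (κ * T.d X) * E (T.r X + m) g (T.descend k U (T.r X + m)) X with hF₀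
  have hpos : 0 < Real.exp (κ * T.d X) := Real.exp_pos _
  refine ⟨extendTower m₀ F₀, extendModuli m₀ Λ, fun g => ?_, ?_, ?_,
    extendModuli_bound hG fun m _ j hj => hΛ m j hj⟩
  · rw [extendTower_of_le F₀ le_rfl, hF₀]
    simp only
    rw [show T.r X + m₀ = k by omega, T.descend_top]
  · refine extendTower_rate hC hθ fun m hm g hg => ?_
    have hn : T.r X + m < k := by omega
    have hrate := rate_of_towerNE5On T h5 (T.r X + m) hg (T.descend k U (T.r X + m + 1)) X
    rw [T.tr_descend hn, Nat.add_sub_cancel_left] at hrate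
    have e : F₀ (m + 1) g - F₀ m (fun i => g (i + 1)) = Real.exp (κ * T.d X) *
        (E (T.r X + m + 1) g (T.descend k U (T.r X + m + 1)) X -
          E (T.r X + m) (fun i => g (i + 1)) (T.descend k U (T.r X + m)) X) := by
      rw [hF₀, ← mul_sub]
      rfl
    rw [e, abs_mul, abs_of_pos hpos]
    calc Real.exp (κ * T.d X) * |E (T.r X + m + 1) g (T.descend k U (T.r X + m + 1)) X -
            E (T.r X + m) (fun i => g (i + 1)) (T.descend k U (T.r X + m)) X|
        ≤ Real.exp (κ * T.d X) * (C₅ * θ ^ m * Real.exp (-(κ * T.d X))) :=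
          mul_le_mul_of_nonneg_left hrate hpos.le
      _ = C₅ * θ ^ m := by rw [Real.exp_neg]; field_simp
  · refine extendTower_moduli (ω := fun t => t) (fun g hg kk => age_mem_boxWindow hg kk) fun m _ g hg g' hg' => ?_
    have h : |E (T.r X + m) g (T.descend k U (T.r X + m)) X - E (T.r X + m) g' (T.descend k U (T.r X + m)) X| ≤
        Real.exp (-(κ * T.d X)) *
          ∑ i ∈ range (T.r X + m - T.r X), Λ (T.r X + m - T.r X) i * |g i - g' i| :=
      h9 (T.r X + m) g hg g' hg' _ X
    rw [Nat.add_sub_cancel_left] at h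
    have e : F₀ m g - F₀ m g' = Real.exp (κ * T.d X) *
        (E (T.r X + m) g (T.descend k U (T.r X + m)) X - E (T.r X + m) g' (T.descend k U (T.r X + m)) X) := by
      rw [hF₀, ← mul_sub]
    rw [e, abs_mul, abs_of_pos hpos]
    calc Real.exp (κ * T.d X) *
          |E (T.r X + m) g (T.descend k U (T.r X + m)) X - E (T.r X + m) g' (T.descend k U (T.r X + m)) X|
        ≤ Real.exp (κ * T.d X) * (Real.exp (-(κ * T.d X)) * ∑ i ∈ range m, Λ m i * |g i - g' i|) :=
          mul_le_mul_of_nonneg_left h hpos.le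
      _ = ∑ i ∈ range m, Λ m i * |g i - g' i| := by
          rw [← mul_assoc, Real.exp_neg, mul_inv_cancel₀ hpos.ne', one_mul]

/-- **END OVER THE BOX, BOUNDED MODULI.**  Tower-NE5 + tower-NE9 over `BoxWindow I` with BOUNDED moduli `0 ≤ Λ m i ≤ C₉` + a discrepancy profile
`|g_i − g'_i| ≤ d_i` (coordinates in the currency of `I`): `|E k g U X − E k g' U X| ≤ e^{−κd(X)}·[2C₅θ^{m∕2}∕(1−θ) + C₉·Σ_{i ∈ [m∕2, m)} d_i]`,
`m = k − r X` (`MemoryFromRate.bracket_le_of_bounded` BY NAME on the section). [folklore] -/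
theorem bracket_le_of_towerOn_bounded {κ θ C₅ C₉ : ℝ} {Λ : ℕ → ℕ → ℝ} {d : ℕ → ℝ}
    (hC : 0 ≤ C₅) (hθ0 : 0 ≤ θ) (hθ1 : θ < 1) (hC9 : 0 ≤ C₉)
    (h5 : TowerNE5On T E I κ θ C₅) (h9 : TowerNE9On T E I κ Λ)
    (hΛ : ∀ m i, i < m → 0 ≤ Λ m i ∧ Λ m i ≤ C₉)
    (k : ℕ) (U : T.B) (X : T.Dom) (hX : T.r X ≤ k)
    {g g' : ℕ → ℝ} (hg : g ∈ BoxWindow I) (hg' : g' ∈ BoxWindow I) (hd : ∀ i, |g i - g' i| ≤ d i) :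
    |E k g U X - E k g' U X| ≤ Real.exp (-(κ * T.d X)) *
      (2 * C₅ * θ ^ ((k - T.r X) / 2) / (1 - θ) + C₉ * ∑ i ∈ Ico ((k - T.r X) / 2) (k - T.r X), d i) := by
  obtain ⟨F, Λ', hF, hT, hL, hΛ'⟩ := section_towerOn T hC hθ0 h5 h9 (G := fun _ => C₉) (fun _ => hC9)
    (fun m j hj => hΛ m j hj) k U X hX
  have hb := bracket_le_of_bounded (W := BoxWindow I) hC hθ0 hθ1 (fun g hg => shift_mem_boxWindow hg)
    (fun g hg g' hg' a => mix_mem_boxWindow hg hg' a) hT hL (fun m i hi => hΛ' m i hi) hg hg' hd (k - T.r X)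
  rw [hF g, hF g', ← mul_sub, abs_mul, abs_of_pos (Real.exp_pos _)] at hb
  have h2 := (le_div_iff₀' (Real.exp_pos _)).mpr hb
  rwa [div_eq_inv_mul, ← Real.exp_neg] at h2

/-- **END OVER THE BOX, GROWING MODULI (clause N2 idle).**  Tower-NE5 + tower-NE9 over `BoxWindow I` with moduli of at most geometric GROWTH
`0 ≤ Λ m i ≤ C₉μ^{m−i}` (ANY `μ ≥ 1`) + a geometric discrepancy `|g_i − g'_i| ≤ Dθ′^i` + `N ≥ 1`:
`|E k g U X − E k g' U X| ≤ e^{−κd(X)}·[2C₅θ^{m∕N}∕(1−θ) + C₉D·(m∕N)·(μθ′^{N−1})^{m∕N}]`, `m = k − r X` (`MemoryFromRate.bracket_le_of_growing` BY NAME). [folklore] -/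
theorem bracket_le_of_towerOn_growing {κ θ C₅ C₉ μ D θ' : ℝ} {Λ : ℕ → ℕ → ℝ}
    (hC : 0 ≤ C₅) (hθ0 : 0 ≤ θ) (hθ1 : θ < 1) (hμ : 1 ≤ μ) (hD : 0 ≤ D) (hθ'0 : 0 ≤ θ') (hθ'1 : θ' ≤ 1)
    (h5 : TowerNE5On T E I κ θ C₅) (h9 : TowerNE9On T E I κ Λ)
    (hΛ : ∀ m i, i < m → 0 ≤ Λ m i ∧ Λ m i ≤ C₉ * μ ^ (m - i))
    {N : ℕ} (hN : 1 ≤ N) (k : ℕ) (U : T.B) (X : T.Dom) (hX : T.r X ≤ k)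
    {g g' : ℕ → ℝ} (hg : g ∈ BoxWindow I) (hg' : g' ∈ BoxWindow I) (hd : ∀ i, |g i - g' i| ≤ D * θ' ^ i) :
    |E k g U X - E k g' U X| ≤ Real.exp (-(κ * T.d X)) *
      (2 * C₅ * θ ^ ((k - T.r X) / N) / (1 - θ) +
        C₉ * D * ((k - T.r X) / N : ℕ) * (μ * θ' ^ (N - 1)) ^ ((k - T.r X) / N)) := by
  have hC9 : 0 ≤ C₉ := by
    have h10 := hΛ 1 0 Nat.one_pos
    have hμpos : 0 < μ ^ (1 - 0) := pow_pos (by linarith) _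
    exact le_of_mul_le_mul_right (by rw [zero_mul]; exact h10.1.trans h10.2) hμpos
  obtain ⟨F, Λ', hF, hT, hL, hΛ'⟩ := section_towerOn T hC hθ0 h5 h9 (G := fun a => C₉ * μ ^ a)
    (fun a => by positivity) hΛ k U X hX
  have hb := bracket_le_of_growing (W := BoxWindow I) hC hθ0 hθ1 hμ hD hθ'0 hθ'1 (fun g hg => shift_mem_boxWindow hg)
    (fun g hg g' hg' a => mix_mem_boxWindow hg hg' a) hT hL hΛ' hg hg' hd hN (k - T.r X)
  rw [hF g, hF g', ← mul_sub, abs_mul, abs_of_pos (Real.exp_pos _)] at hb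
  have h2 := (le_div_iff₀' (Real.exp_pos _)).mpr hb
  rwa [div_eq_inv_mul, ← Real.exp_neg] at h2

/-- **END-TO-END OVER THE BOX, NODE U6, BOUNDED MODULI.**  Under the hypotheses of `bracket_le_of_towerOn_bounded` with a nonnegative
discrepancy profile of FINITE FIRST MOMENT (`Σ (i+1)·d_i < ∞` — the record's `C·θ′^i` and (E33g)'s `L·ρ^⌊√i⌋` both qualify,
`MemoryFromRate.firstMoment_profiles`), the CUTOFF-INDEPENDENT injection `inj K j := 2C₅θ^{j∕2}∕(1−θ) + C₉·Σ_{i∈[j∕2,j)} d_i` (i) DOMINATES node U3's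
coupling bracket of EVERY pair of admissible histories with that profile, at EVERY domain of EVERY run, and (ii) has
`Summable (T4CauchySum.delta E₀ ρ inj)` for every `0 ≤ E₀`, `0 ≤ ρ < 1` (`MemoryFromRate.summable_delta_of_bounded` BY NAME).  NO decay, NO growth
budget, NO clause N2 — the moduli are merely BOUNDED (gen 4 typed the end-to-end statement only in the growing∕geometric regime). [folklore] -/
theorem summable_delta_of_towerOn_bounded {κ θ C₅ C₉ : ℝ} {Λ : ℕ → ℕ → ℝ} {d : ℕ → ℝ}
    (hC : 0 ≤ C₅) (hθ0 : 0 ≤ θ) (hθ1 : θ < 1) (hC9 : 0 ≤ C₉) (hκ : 0 ≤ κ)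
    (h5 : TowerNE5On T E I κ θ C₅) (h9 : TowerNE9On T E I κ Λ)
    (hΛ : ∀ m i, i < m → 0 ≤ Λ m i ∧ Λ m i ≤ C₉)
    (hd0 : ∀ i, 0 ≤ d i) (hd1 : Summable (fun i : ℕ => ((i : ℝ) + 1) * d i))
    {E₀ ρ : ℝ} (hE : 0 ≤ E₀) (hρ : 0 ≤ ρ) (hρ1 : ρ < 1) :
    let inj : ℕ → ℕ → ℝ := fun _ j => 2 * C₅ * θ ^ (j / 2) / (1 - θ) + C₉ * ∑ i ∈ Ico (j / 2) j, d i
    (∀ (K k : ℕ) (U : T.B) (X : T.Dom), T.r X ≤ k → ∀ g ∈ BoxWindow I, ∀ g' ∈ BoxWindow I,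
        (∀ i, |g i - g' i| ≤ d i) → |E k g U X - E k g' U X| ≤ inj K (k - T.r X)) ∧
      Summable (delta E₀ ρ inj) := by
  intro inj
  have hinj0 : ∀ K j, 0 ≤ inj K j := fun K j =>
    add_nonneg (div_nonneg (by positivity) (by linarith)) (mul_nonneg hC9 (sum_nonneg fun i _ => hd0 i))
  refine ⟨fun K k U X hX g hg g' hg' hd => ?_, ?_⟩
  · have h := bracket_le_of_towerOn_bounded T hC hθ0 hθ1 hC9 h5 h9 hΛ k U X hX hg hg' hd
    refine h.trans ?_
    have hexp : Real.exp (-(κ * T.d X)) ≤ 1 :=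
      Real.exp_le_one_iff.mpr (by have := T.d_nonneg X; nlinarith)
    calc Real.exp (-(κ * T.d X)) * inj K (k - T.r X) ≤ 1 * inj K (k - T.r X) :=
          mul_le_mul_of_nonneg_right hexp (hinj0 K _)
      _ = inj K (k - T.r X) := one_mul _
  · exact summable_delta_of_bounded hC hθ0 hθ1 hC9 hd0 hd1 hE hρ hρ1 fun K j _ => ⟨hinj0 K j, le_rfl⟩

/-! ## §3 THE ANALYTIC BRANCH along the tower, t-currency: relative-disc coupling holomorphy at every level ⇒ bounded t-moduli ⇒ node U6 -/

/-- **RELATIVE-DISC COUPLING HOLOMORPHY AT EVERY LEVEL ⇒ TOWER-NE9 IN t WITH BOUNDED MODULI `4M∕(c·t₀)`.**  If every level-`k` functional, as a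
function of the t-HISTORY `(1∕g₀², 1∕g₁², …)` over the t-box `[t₀, ∞[` (`t₀ = γ⁻²`), has the printed-in-words prefix dependence and the owner
lineage's [H-dil] shape `CouplingAnalyticRel [t₀,∞[ (E k) κ M c` (each young coupling separately holomorphic on the relative disc `|z − s| ≤ c·s`
about every `s ≥ t₀`, bound `M·e^{−κd(X)}`), then `TowerNE9On T E [t₀,∞[ κ (4M∕(c t₀))` — Cauchy, `ne9T_of_couplingAnalyticRel` BY NAME, level by
level.  NO decay and NO growth of the moduli; NO step structure. [folklore] -/
theorem towerNE9On_of_couplingAnalyticRel {t₀ κ M c : ℝ} (ht₀ : 0 < t₀) (hc : 0 < c)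
    (hP : ∀ k, PrefixDependenceOn (C := T.level k) (E k) (BoxWindow (Set.Ici t₀)))
    (hA : ∀ k, CouplingAnalyticRel (C := T.level k) (Set.Ici t₀) (E k) κ M c) :
    TowerNE9On T E (Set.Ici t₀) κ (fun _ _ => 4 * M / (c * t₀)) :=
  fun k => ne9T_of_couplingAnalyticRel ht₀ hc (hP k) (hA k)

/-- **THE ANALYTIC BRANCH — NODE U3's BRACKET.**  Tower-NE5 over the t-box + relative-disc coupling holomorphy at every level (`0 ≤ M`) + a
t-discrepancy profile `|t_i − t'_i| ≤ d_i`: `|E k t U X − E k t' U X| ≤ e^{−κd(X)}·[2C₅θ^{m∕2}∕(1−θ) + (4M∕(c t₀))·Σ_{i∈[m∕2,m)} d_i]`, `m = k − r X`.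
[folklore] -/
theorem bracket_le_of_analyticBranch {t₀ κ θ C₅ M c : ℝ} {d : ℕ → ℝ} (ht₀ : 0 < t₀) (hc : 0 < c) (hM : 0 ≤ M)
    (hC : 0 ≤ C₅) (hθ0 : 0 ≤ θ) (hθ1 : θ < 1)
    (h5 : TowerNE5On T E (Set.Ici t₀) κ θ C₅)
    (hP : ∀ k, PrefixDependenceOn (C := T.level k) (E k) (BoxWindow (Set.Ici t₀)))
    (hA : ∀ k, CouplingAnalyticRel (C := T.level k) (Set.Ici t₀) (E k) κ M c)
    (k : ℕ) (U : T.B) (X : T.Dom) (hX : T.r X ≤ k)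
    {t t' : ℕ → ℝ} (ht : t ∈ BoxWindow (Set.Ici t₀)) (ht' : t' ∈ BoxWindow (Set.Ici t₀)) (hd : ∀ i, |t i - t' i| ≤ d i) :
    |E k t U X - E k t' U X| ≤ Real.exp (-(κ * T.d X)) *
      (2 * C₅ * θ ^ ((k - T.r X) / 2) / (1 - θ) + 4 * M / (c * t₀) * ∑ i ∈ Ico ((k - T.r X) / 2) (k - T.r X), d i) :=
  bracket_le_of_towerOn_bounded T hC hθ0 hθ1 (by positivity) h5 (towerNE9On_of_couplingAnalyticRel T ht₀ hc hP hA)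
    (fun _ _ _ => ⟨by positivity, le_rfl⟩) k U X hX ht ht' hd

/-- **THE ANALYTIC BRANCH — END-TO-END, NODE U6.**  Tower-NE5 over the t-box `[t₀,∞[` + prefix dependence + relative-disc coupling holomorphy
`CouplingAnalyticRel [t₀,∞[ (E k) κ M c` at EVERY level in EVERY young coupling with ONE bound `M ≥ 0` + a nonnegative t-discrepancy profile of
finite first moment: the cutoff-independent injection `inj K j := 2C₅θ^{j∕2}∕(1−θ) + (4M∕(c t₀))·Σ_{i∈[j∕2,j)} d_i` dominates node U3's bracket of every
admissible pair of t-histories with that profile at every domain of every run, AND `Summable (T4CauchySum.delta E₀ ρ inj)` (`0 ≤ E₀`, `0 ≤ ρ < 1`).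
USED: Cauchy on relative discs (`ne9T_of_couplingAnalyticRel`), tower-NE5, the young∕old split (`MemoryFromRate`).  NOT USED: `StepLipschitz` ∕
`StepTransfer` ∕ renewal, (AN-OLD), (CONTR), the memory-rate gap of `T4CurrencyMatching`, the vertex weight (W5), `FadingMemory`, clause N2.
[folklore] -/
theorem summable_delta_of_analyticBranch {t₀ κ θ C₅ M c : ℝ} {d : ℕ → ℝ} (ht₀ : 0 < t₀) (hc : 0 < c) (hM : 0 ≤ M)
    (hC : 0 ≤ C₅) (hθ0 : 0 ≤ θ) (hθ1 : θ < 1) (hκ : 0 ≤ κ)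
    (h5 : TowerNE5On T E (Set.Ici t₀) κ θ C₅)
    (hP : ∀ k, PrefixDependenceOn (C := T.level k) (E k) (BoxWindow (Set.Ici t₀)))
    (hA : ∀ k, CouplingAnalyticRel (C := T.level k) (Set.Ici t₀) (E k) κ M c)
    (hd0 : ∀ i, 0 ≤ d i) (hd1 : Summable (fun i : ℕ => ((i : ℝ) + 1) * d i))
    {E₀ ρ : ℝ} (hE : 0 ≤ E₀) (hρ : 0 ≤ ρ) (hρ1 : ρ < 1) :
    let inj : ℕ → ℕ → ℝ := fun _ j => 2 * C₅ * θ ^ (j / 2) / (1 - θ) + 4 * M / (c * t₀) * ∑ i ∈ Ico (j / 2) j, d i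
    (∀ (K k : ℕ) (U : T.B) (X : T.Dom), T.r X ≤ k → ∀ t ∈ BoxWindow (Set.Ici t₀), ∀ t' ∈ BoxWindow (Set.Ici t₀),
        (∀ i, |t i - t' i| ≤ d i) → |E k t U X - E k t' U X| ≤ inj K (k - T.r X)) ∧
      Summable (delta E₀ ρ inj) :=
  summable_delta_of_towerOn_bounded T hC hθ0 hθ1 (by positivity) hκ h5 (towerNE9On_of_couplingAnalyticRel T ht₀ hc hP hA)
    (fun _ _ _ => ⟨by positivity, le_rfl⟩) hd0 hd1 hE hρ hρ1

/-! ## §4 Dictionary to node U2: the t-discrepancy of the paired histories IS `T4CouplingMatching.disc`; the cell's two profiles -/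

/-- **THE t-DISCREPANCY IS NODE U2's NATIVE OUTPUT** (weight 1, no `γ³∕2`): for coupling runs `g K` (run `K`, bare coupling `g K 0`) the
t-histories of the level-`K` pair — run `K`'s `1∕(g K i)²` and run `K+1`'s RE-INDEXED `1∕(g (K+1) (i+1))²` — differ at index `i` by EXACTLY pv16's
`T4CouplingMatching.disc (g K) (g (K+1)) i` (the quantity node U2 bounds: record `C·θ^i`, (E33g) `L·ρ^⌊√i⌋`); by `rfl`.  Contrast gen 3's
`SchurMemoryJunction.couplingDisc_le_of_disc` (g-currency, factor `γ³`). [folklore] -/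
theorem abs_invSq_sub_eq_disc (g : ℕ → ℕ → ℝ) (K i : ℕ) :
    |1 / (g K i) ^ 2 - 1 / (g (K + 1) (i + 1)) ^ 2| = T4CouplingMatching.disc (g K) (g (K + 1)) i := rfl

/-- The t-history of a g-window history lies in the t-box `[γ⁻², ∞[`. [folklore] -/
theorem invSq_mem_boxWindow {γ : ℝ} {h : ℕ → ℝ} (hh : h ∈ Window γ) :
    (fun i => 1 / (h i) ^ 2) ∈ BoxWindow (Set.Ici (γ ^ 2)⁻¹) := by
  intro i
  obtain ⟨h0, hγ⟩ := hh i
  show (γ ^ 2)⁻¹ ≤ 1 / (h i) ^ 2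
  rw [one_div]
  exact inv_anti₀ (pow_pos h0 2) (pow_le_pow_left₀ h0.le hγ 2)

/-- **THE ANALYTIC BRANCH IN THE RECORD's REGIME**: node U2's geometric t-profile `disc ≤ C·θ′^i` (`0 ≤ C`, `0 ≤ θ′ < 1`) has a finite first
moment (`MemoryFromRate.firstMoment_profiles`), so `summable_delta_of_analyticBranch` fires with `d_i = C·θ′^i`. [folklore] -/
theorem summable_delta_of_analyticBranch_geometric {t₀ κ θ C₅ M c Cθ θ' : ℝ} (ht₀ : 0 < t₀) (hc : 0 < c) (hM : 0 ≤ M)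
    (hC : 0 ≤ C₅) (hθ0 : 0 ≤ θ) (hθ1 : θ < 1) (hκ : 0 ≤ κ) (hCθ : 0 ≤ Cθ) (hθ'0 : 0 ≤ θ') (hθ'1 : θ' < 1)
    (h5 : TowerNE5On T E (Set.Ici t₀) κ θ C₅)
    (hP : ∀ k, PrefixDependenceOn (C := T.level k) (E k) (BoxWindow (Set.Ici t₀)))
    (hA : ∀ k, CouplingAnalyticRel (C := T.level k) (Set.Ici t₀) (E k) κ M c)
    {E₀ ρ : ℝ} (hE : 0 ≤ E₀) (hρ : 0 ≤ ρ) (hρ1 : ρ < 1) :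
    let inj : ℕ → ℕ → ℝ := fun _ j =>
      2 * C₅ * θ ^ (j / 2) / (1 - θ) + 4 * M / (c * t₀) * ∑ i ∈ Ico (j / 2) j, Cθ * θ' ^ i
    (∀ (K k : ℕ) (U : T.B) (X : T.Dom), T.r X ≤ k → ∀ t ∈ BoxWindow (Set.Ici t₀), ∀ t' ∈ BoxWindow (Set.Ici t₀),
        (∀ i, |t i - t' i| ≤ Cθ * θ' ^ i) → |E k t U X - E k t' U X| ≤ inj K (k - T.r X)) ∧
      Summable (delta E₀ ρ inj) :=
  summable_delta_of_analyticBranch T ht₀ hc hM hC hθ0 hθ1 hκ h5 hP hA (fun i => by positivity)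
    (firstMoment_profiles (L := 0) hθ'0 hθ'1 le_rfl zero_lt_one).1 hE hρ hρ1

/-- **THE ANALYTIC BRANCH IN (E33g)'s REGIME** (NO β-side `FadingMemory`): node U2's K-uniform stretched t-profile `disc ≤ L·ρ₂^⌊√i⌋` (`0 ≤ L`,
`0 ≤ ρ₂ < 1`; the shape of `Beta.EriceRemainderEnclosureHistoryRenewalStretched.disc_le_sqrt_uniform_sign`) has a finite first moment, so
`summable_delta_of_analyticBranch` fires with `d_i = L·ρ₂^⌊√i⌋` — node U6 with NO fading on EITHER side and NO step analysis on the E-side. [folklore] -/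
theorem summable_delta_of_analyticBranch_sqrt {t₀ κ θ C₅ M c L ρ₂ : ℝ} (ht₀ : 0 < t₀) (hc : 0 < c) (hM : 0 ≤ M)
    (hC : 0 ≤ C₅) (hθ0 : 0 ≤ θ) (hθ1 : θ < 1) (hκ : 0 ≤ κ) (hL : 0 ≤ L) (hρ₂0 : 0 ≤ ρ₂) (hρ₂1 : ρ₂ < 1)
    (h5 : TowerNE5On T E (Set.Ici t₀) κ θ C₅)
    (hP : ∀ k, PrefixDependenceOn (C := T.level k) (E k) (BoxWindow (Set.Ici t₀)))
    (hA : ∀ k, CouplingAnalyticRel (C := T.level k) (Set.Ici t₀) (E k) κ M c)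
    {E₀ ρ : ℝ} (hE : 0 ≤ E₀) (hρ : 0 ≤ ρ) (hρ1 : ρ < 1) :
    let inj : ℕ → ℕ → ℝ := fun _ j =>
      2 * C₅ * θ ^ (j / 2) / (1 - θ) + 4 * M / (c * t₀) * ∑ i ∈ Ico (j / 2) j, L * ρ₂ ^ Nat.sqrt i
    (∀ (K k : ℕ) (U : T.B) (X : T.Dom), T.r X ≤ k → ∀ t ∈ BoxWindow (Set.Ici t₀), ∀ t' ∈ BoxWindow (Set.Ici t₀),
        (∀ i, |t i - t' i| ≤ L * ρ₂ ^ Nat.sqrt i) → |E k t U X - E k t' U X| ≤ inj K (k - T.r X)) ∧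
      Summable (delta E₀ ρ inj) :=
  summable_delta_of_analyticBranch T ht₀ hc hM hC hθ0 hθ1 hκ h5 hP hA (fun i => by positivity)
    (firstMoment_profiles (Cθ := 0) le_rfl zero_lt_one hρ₂0 hρ₂1).2 hE hρ hρ1

end Summit.QuantumFields.BalabanUV.T4Continuum.NE9.TowerCarriersBox
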